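import Mathlib
import HarnessLib
import Literature.MathematicalPhysics.QuantumLattice.HubbardBandSectorCountingToolbox

/-!
# Route `KLProgramme` — definitions for the support item `CountPairsOffset` (stmt-HubbardSuperconductivity-20036):
# the offset level function of the sector count

The landed toolbox `Literature/…/HubbardBandSectorCountingBounds.lean` defines the level function of THREE CURVE POINTS
`hfun μ θ₁ θ₂ θ₃ = ε₂(p(θ₁) + p(θ₂) + p(θ₃)) - μ` with its partials `h3`, `h33` and the anti-diagonal combination `Gfun`.
Item `CountPairsOffset` (DECOMP App. F Lemma F.1, cell gate-hubbard-kl; the `2n`-leg sector count modulo `2πℤ²`) replaces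
the first curve point by an ARBITRARY offset `P ∈ ℝ²`. This file only NAMES the corresponding objects — nothing is proved
here beyond `rfl`-bookkeeping:

* `SXP μ P θ₂ θ₃ = P₁ + X(θ₂) + X(θ₃)`, `SYP μ P θ₂ θ₃ = P₂ + Y(θ₂) + Y(θ₃)` — the momentum sum;
* `hfunP μ P θ₂ θ₃ = ε₂(SXP, SYP) - μ` — the offset level function (planner g5's `hfunP`, REF-CHECK §13.3; the item quotes
  its inlined form, `hfunP_eq`); momentum conservation modulo `2πℤ²` is automatic (`ε₂` is `2π`-periodic, evaluated at the SUM);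
* `h3P`, `h33P` — `∂₃ h_P` and `∂₃∂₃ h_P`; `GfunP` — `(∂₂ + ∂₃) h_P` along the anti-diagonal `(σ - s/2, σ + s/2)`;
* the symmetry `θ₂ ↔ θ₃` and the reduction to the tree's objects at `P = p(θ₁)` (`hfunP_band` etc., all `rfl`).

The analysis (derivatives, bounds, non-degeneracy, counts) is in the `KLProgrammeCountPairsOffset*.lean` files.
Reference: G. Benfatto, A. Giuliani, V. Mastropietro, Ann. Henri Poincaré 7 (2006) 809–898, Lemma 3.1 / App. A2.
-/

noncomputable section

namespace Summit.HubbardSuperconductivity.HubbardSuperconductivity.Theorems.CountPairsOffset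

set_option linter.dupNamespace false -- summit = problem name (single-conjunct summit), D-0017

open Real Set
open Literature.MathematicalPhysics.QuantumLattice Literature.MathematicalPhysics.QuantumLattice.BandSectorCounting

/-- `S_x = P₁ + X(θ₂) + X(θ₃)`: first coordinate of the momentum sum with offset `P`. -/
def SXP (μ : ℝ) (P : ℝ × ℝ) (θ₂ θ₃ : ℝ) : ℝ := P.1 + bandX μ θ₂ + bandX μ θ₃

/-- `S_y = P₂ + Y(θ₂) + Y(θ₃)`: second coordinate of the momentum sum with offset `P`. -/
def SYP (μ : ℝ) (P : ℝ × ℝ) (θ₂ θ₃ : ℝ) : ℝ := P.2 + bandY μ θ₂ + bandY μ θ₃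

/-- **The offset level function** `h_P(θ₂, θ₃) = ε₂(P + p(θ₂) + p(θ₃)) - μ` (momentum conservation modulo `2πℤ²` is
automatic: `ε₂` is `2π`-periodic and is evaluated at the SUM). -/
def hfunP (μ : ℝ) (P : ℝ × ℝ) (θ₂ θ₃ : ℝ) : ℝ := eps2 (SXP μ P θ₂ θ₃) (SYP μ P θ₂ θ₃) - μ

/-- `∂₃ h_P = 2 sin S_x · X'(θ₃) + 2 sin S_y · Y'(θ₃)`. -/
def h3P (μ : ℝ) (P : ℝ × ℝ) (θ₂ θ₃ : ℝ) : ℝ :=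
  2 * Real.sin (SXP μ P θ₂ θ₃) * bandVX μ θ₃ + 2 * Real.sin (SYP μ P θ₂ θ₃) * bandVY μ θ₃

/-- `∂₃∂₃ h_P`. -/
def h33P (μ : ℝ) (P : ℝ × ℝ) (θ₂ θ₃ : ℝ) : ℝ :=
  2 * (Real.cos (SXP μ P θ₂ θ₃) * bandVX μ θ₃ * bandVX μ θ₃ + Real.sin (SXP μ P θ₂ θ₃) * bandAX μ θ₃) +
  2 * (Real.cos (SYP μ P θ₂ θ₃) * bandVY μ θ₃ * bandVY μ θ₃ + Real.sin (SYP μ P θ₂ θ₃) * bandAY μ θ₃)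

/-- `G_P(t) = (∂₂ + ∂₃) h_P` along the anti-diagonal `(σ - t/2, σ + t/2)`. -/
def GfunP (μ : ℝ) (P : ℝ × ℝ) (σ s : ℝ) : ℝ :=
  2 * (Real.sin (SXP μ P (σ - s / 2) (σ + s / 2)) * (bandVX μ (σ - s / 2) + bandVX μ (σ + s / 2))) +
    2 * (Real.sin (SYP μ P (σ - s / 2) (σ + s / 2)) * (bandVY μ (σ - s / 2) + bandVY μ (σ + s / 2)))

/-- The inlined form of `h_P` (the shape in which route items quote it). -/
theorem hfunP_eq (μ : ℝ) (P : ℝ × ℝ) (θ₂ θ₃ : ℝ) :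
    hfunP μ P θ₂ θ₃ = eps2 (P.1 + bandX μ θ₂ + bandX μ θ₃) (P.2 + bandY μ θ₂ + bandY μ θ₃) - μ := rfl

/-- Symmetry of `S_x`. -/
theorem SXP_swap (μ : ℝ) (P : ℝ × ℝ) (θ₂ θ₃ : ℝ) : SXP μ P θ₂ θ₃ = SXP μ P θ₃ θ₂ := by unfold SXP; ring

/-- Symmetry of `S_y`. -/
theorem SYP_swap (μ : ℝ) (P : ℝ × ℝ) (θ₂ θ₃ : ℝ) : SYP μ P θ₂ θ₃ = SYP μ P θ₃ θ₂ := by unfold SYP; ring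

/-- Symmetry of `h_P`. -/
theorem hfunP_swap (μ : ℝ) (P : ℝ × ℝ) (θ₂ θ₃ : ℝ) : hfunP μ P θ₂ θ₃ = hfunP μ P θ₃ θ₂ := by
  unfold hfunP; rw [SXP_swap, SYP_swap]

/-- At `P = p(θ₁)` the offset sum is the tree's three-point sum. -/
theorem SXP_band (μ θ₁ θ₂ θ₃ : ℝ) : SXP μ (bandX μ θ₁, bandY μ θ₁) θ₂ θ₃ = SX μ θ₁ θ₂ θ₃ := rfl

/-- At `P = p(θ₁)` the offset sum is the tree's three-point sum. -/
theorem SYP_band (μ θ₁ θ₂ θ₃ : ℝ) : SYP μ (bandX μ θ₁, bandY μ θ₁) θ₂ θ₃ = SY μ θ₁ θ₂ θ₃ := rfl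

/-- At `P = p(θ₁)` the offset level function is the tree's `hfun`. -/
theorem hfunP_band (μ θ₁ θ₂ θ₃ : ℝ) : hfunP μ (bandX μ θ₁, bandY μ θ₁) θ₂ θ₃ = hfun μ θ₁ θ₂ θ₃ := rfl

/-- At `P = p(θ₁)`, `∂₃ h_P` is the tree's `∂₃ h`. -/
theorem h3P_band (μ θ₁ θ₂ θ₃ : ℝ) : h3P μ (bandX μ θ₁, bandY μ θ₁) θ₂ θ₃ = h3 μ θ₁ θ₂ θ₃ := rfl

/-- At `P = p(θ₁)`, `G_P` is the tree's `G`. -/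
theorem GfunP_band (μ θ₁ σ s : ℝ) : GfunP μ (bandX μ θ₁, bandY μ θ₁) σ s = Gfun μ θ₁ σ s := rfl

/-- `G_P = ∂₂ h_P + ∂₃ h_P` on the anti-diagonal. -/
theorem GfunP_eq_h3P_add (μ : ℝ) (P : ℝ × ℝ) (σ t : ℝ) :
    GfunP μ P σ t = h3P μ P (σ + t / 2) (σ - t / 2) + h3P μ P (σ - t / 2) (σ + t / 2) := by
  unfold GfunP h3P; rw [SXP_swap μ P (σ + t / 2) (σ - t / 2), SYP_swap μ P (σ + t / 2) (σ - t / 2)]; ring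

end Summit.HubbardSuperconductivity.HubbardSuperconductivity.Theorems.CountPairsOffset

end
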